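import Summits.AtomisticToContinuum.HydrodynamicLimit.Theorems.JParityClosureCollisionTightnessTorusGibbs
import HarnessLib

/-!
# `JParityClosure.CollisionTightness` (stmt-AtomisticToContinuum-13085), rung 0, step 3:
# the position integral and the one-particle reductions of the window bound

Helper file (`--supports stmt-AtomisticToContinuum-13085`).  Ingredients of the window bound for
the mean collision number of `N + 1` hard spheres of diameter `ε_N = σ (N+1)^{-1/3}` on `𝕋³` under a
homogeneous Gibbs law (next file):

* `exists_lift_of_contact` — a minimal-image contact after free flights lifts to `ℝ³`: some lift
  `r' = reprSym (xᵢ − xⱼ) + k`, `k ∈ ℤ³`, has `‖r'‖ ≥ ε` and `‖r' + t (vᵢ − vⱼ)‖ = ε`;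
* `lintegral_pos_window_le` — integrating the centre `xᵢ` first (`measurePreserving_piFinSuccAbove`)
  and using `volume_setOf_exists_reprSym_add_latticeVec_mem_le`, the Haar integral of
  `𝟙{others do not overlap} · 𝟙{∃ k, reprSym (xᵢ − xⱼ) + k ∈ T}` is at most `vol T · vol (posDomain ε N)`;
* `volume_posDomain_le_two_mul` — at reduced density `σ ≤ 1/4`,
  `vol (posDomain ε_N N) ≤ 2 vol (posDomain ε_N (N+1))` (insertion bound, `vol B_ε ≤ (2ε)³`);
* `lintegral_enorm_vel_sub_le` — `E‖vᵢ − vⱼ‖ ≤ 2 E_γ‖w − ū‖` under the product Gaussian law.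

References: C. Cercignani, R. Illner, M. Pulvirenti, *The Mathematical Theory of Dilute Gases*
(1994), App. 4.A; H. Spohn, *Large Scale Dynamics of Interacting Particles* (1991), Part I §2.2.
-/

noncomputable section

open MeasureTheory Set Filter Topology
open scoped ENNReal InnerProductSpace

namespace Summit.AtomisticToContinuum.HydrodynamicLimit.Theorems

open Literature.Analysis.FluidPDE Literature.MathematicalPhysics.KineticTheory
open Literature.Analysis.FunctionSpaces

/-! ### The window bound under a homogeneous Gibbs law -/

/-- **Lifting a contact to `ℝ³`.** If two centres at minimal-image distance `≥ ε` are, after free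
flights `xᵢ + t vᵢ`, `xⱼ + t vⱼ`, at minimal-image distance exactly `ε`, then some lift
`r' = reprSym (xᵢ − xⱼ) + k`, `k ∈ ℤ³`, of their relative position has `‖r'‖ ≥ ε` and
`‖r' + t (vᵢ − vⱼ)‖ = ε`. [folklore] -/
theorem exists_lift_of_contact {ε t : ℝ} {xi xj : T3} {vi vj : V3}
    (hD : ε ≤ Torus.euclidDist xi xj)
    (hc : Torus.euclidDist (xi + Torus.proj (t • vi)) (xj + Torus.proj (t • vj)) = ε) :
    ∃ k : Fin 3 → ℤ, ε ≤ ‖Torus.reprSym (xi - xj) + Torus.latticeVec k‖ ∧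
      ‖(Torus.reprSym (xi - xj) + Torus.latticeVec k) + t • (vi - vj)‖ = ε := by
  set r : V3 := Torus.reprSym (xi - xj) with hr
  set w : V3 := r + t • (vi - vj) with hw
  have hdiff : (xi + Torus.proj (t • vi)) - (xj + Torus.proj (t • vj)) = Torus.proj w := by
    have h1 : Torus.proj (t • vi) - Torus.proj (t • vj) = Torus.proj (t • vi - t • vj) := by
      rw [sub_eq_add_neg, ← Torus.proj_neg, ← Torus.proj_add, ← sub_eq_add_neg]
    have h2 : xi - xj = Torus.proj r := (Torus.proj_reprSym (xi - xj)).symm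
    calc (xi + Torus.proj (t • vi)) - (xj + Torus.proj (t • vj))
        = (xi - xj) + (Torus.proj (t • vi) - Torus.proj (t • vj)) := by abel
      _ = Torus.proj r + Torus.proj (t • vi - t • vj) := by rw [h1, h2]
      _ = Torus.proj w := by rw [hw, Torus.proj_add, smul_sub]
  obtain ⟨k, hk⟩ := (Torus.proj_eq_proj_iff_holds w (Torus.reprSym (Torus.proj w))).1
    (Torus.proj_reprSym (Torus.proj w)).symm
  refine ⟨k, ?_, ?_⟩
  · have hproj : Torus.proj (r + Torus.latticeVec k) = xi - xj := by
      rw [Torus.proj_add_latticeVec, hr, Torus.proj_reprSym]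
    exact hD.trans (Torus.norm_reprSym_le_of_proj_eq hproj)
  · have hε : Torus.euclidDist (xi + Torus.proj (t • vi)) (xj + Torus.proj (t • vj)) = ‖Torus.reprSym (Torus.proj w)‖ := by
      rw [Torus.euclidDist, hdiff]
    rw [← hc, hε, hk, hw]
    congr 1
    abel

/-- Sections of the lifted set are measurable: for fixed `c`,
`{y | ∃ k, reprSym (y − c) + k ∈ T}` is measurable. [folklore] -/
theorem measurableSet_exists_reprSym_sub_add_mem (c : T3) {T : Set V3} (hT : MeasurableSet T) :
    MeasurableSet {y : T3 | ∃ k : Fin 3 → ℤ, Torus.reprSym (y - c) + Torus.latticeVec k ∈ T} := by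
  have : {y : T3 | ∃ k : Fin 3 → ℤ, Torus.reprSym (y - c) + Torus.latticeVec k ∈ T} =
      ⋃ k : Fin 3 → ℤ, (fun y : T3 => Torus.reprSym (y - c) + Torus.latticeVec k) ⁻¹' T := by
    ext y; simp
  rw [this]
  refine MeasurableSet.iUnion fun k => hT.preimage ?_
  exact (Torus.measurable_reprSym.comp (measurable_id.sub measurable_const)).add_const _

/-- The lifted pair set is measurable, jointly in the two centres. [folklore] -/
theorem measurableSet_exists_reprSym_pair_mem {N : ℕ} (i j : Fin (N + 1)) {T : Set V3}
    (hT : MeasurableSet T) :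
    MeasurableSet {x : Fin (N + 1) → T3 | ∃ k : Fin 3 → ℤ,
      Torus.reprSym (x i - x j) + Torus.latticeVec k ∈ T} := by
  have : {x : Fin (N + 1) → T3 | ∃ k : Fin 3 → ℤ, Torus.reprSym (x i - x j) + Torus.latticeVec k ∈ T} =
      ⋃ k : Fin 3 → ℤ, (fun x : Fin (N + 1) → T3 => Torus.reprSym (x i - x j) + Torus.latticeVec k) ⁻¹' T := by
    ext x; simp
  rw [this]
  refine MeasurableSet.iUnion fun k => hT.preimage ?_
  exact (Torus.measurable_reprSym.comp ((measurable_pi_apply i).sub (measurable_pi_apply j))).add_const _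

/-- **The position integral.** For a measurable `T ⊆ ℝ³`, a label `i` and another label
`j = i.succAbove j'`, the Haar integral over the `N + 1` centres of
`𝟙{the centres other than i do not overlap} · 𝟙{∃ k, reprSym (xᵢ − xⱼ) + k ∈ T}` is at most
`vol T · vol (posDomain ε N)` (Fubini over `xᵢ` first, `measurePreserving_piFinSuccAbove`, and
`volume_setOf_exists_reprSym_add_latticeVec_mem_le`). [folklore] -/
theorem lintegral_pos_window_le {ε : ℝ} {N : ℕ} (i : Fin (N + 1)) (j' : Fin N) {T : Set V3}
    (hT : MeasurableSet T) :
    ∫⁻ x : Fin (N + 1) → T3, (posDomain ε N).indicator 1 (Fin.removeNth i x) *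
        {x' : Fin (N + 1) → T3 | ∃ k : Fin 3 → ℤ,
          Torus.reprSym (x' i - x' (i.succAbove j')) + Torus.latticeVec k ∈ T}.indicator 1 x ≤
      volume T * volume (posDomain ε N) := by
  have hmp : MeasurePreserving (MeasurableEquiv.piFinSuccAbove (fun _ : Fin (N + 1) => T3) i)
      volume volume :=
    volume_preserving_piFinSuccAbove (fun _ : Fin (N + 1) => T3) i
  have hvol : (volume : Measure (T3 × (Fin N → T3))) = (volume : Measure T3).prod volume := rfl
  -- the lifted set on the product side is measurable
  have hW : MeasurableSet {q : T3 × (Fin N → T3) | ∃ k : Fin 3 → ℤ,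
      Torus.reprSym (q.1 - q.2 j') + Torus.latticeVec k ∈ T} := by
    have : {q : T3 × (Fin N → T3) | ∃ k : Fin 3 → ℤ,
        Torus.reprSym (q.1 - q.2 j') + Torus.latticeVec k ∈ T} =
        ⋃ k : Fin 3 → ℤ, (fun q : T3 × (Fin N → T3) =>
          Torus.reprSym (q.1 - q.2 j') + Torus.latticeVec k) ⁻¹' T := by
      ext q; simp
    rw [this]
    refine MeasurableSet.iUnion fun k => hT.preimage ?_
    exact (Torus.measurable_reprSym.comp
      (measurable_fst.sub ((measurable_pi_apply j').comp measurable_snd))).add_const _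
  -- product-side integrand
  set Fp : T3 × (Fin N → T3) → ℝ≥0∞ := fun p =>
    (posDomain ε N).indicator 1 p.2 *
      {q : T3 × (Fin N → T3) | ∃ k : Fin 3 → ℤ,
        Torus.reprSym (q.1 - q.2 j') + Torus.latticeVec k ∈ T}.indicator 1 p with hFp
  have hFpm : Measurable Fp :=
    ((measurable_one.indicator (measurableSet_posDomain ε N)).comp measurable_snd).mul
      (measurable_one.indicator hW)
  -- change of variables
  have hcomp : (fun x : Fin (N + 1) → T3 => (posDomain ε N).indicator 1 (Fin.removeNth i x) *
      {x' : Fin (N + 1) → T3 | ∃ k : Fin 3 → ℤ,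
        Torus.reprSym (x' i - x' (i.succAbove j')) + Torus.latticeVec k ∈ T}.indicator 1 x) =
      fun x => Fp (MeasurableEquiv.piFinSuccAbove (fun _ : Fin (N + 1) => T3) i x) := by
    funext x
    rfl
  rw [hcomp, ← lintegral_map_equiv Fp (MeasurableEquiv.piFinSuccAbove (fun _ : Fin (N + 1) => T3) i),
    hmp.map_eq, hvol, lintegral_prod_symm _ hFpm.aemeasurable]
  -- inner integral over `y`
  have hinner : ∀ x' : Fin N → T3, ∫⁻ y, Fp (y, x') ≤
      (posDomain ε N).indicator 1 x' * volume T := by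
    intro x'
    have hsec : (fun y : T3 => Fp (y, x')) = fun y => (posDomain ε N).indicator 1 x' *
        {y : T3 | ∃ k : Fin 3 → ℤ, Torus.reprSym (y - x' j') + Torus.latticeVec k ∈ T}.indicator 1 y := by
      funext y
      rfl
    rw [hsec, lintegral_const_mul _ (measurable_one.indicator
      (measurableSet_exists_reprSym_sub_add_mem (x' j') hT)),
      lintegral_indicator_one (measurableSet_exists_reprSym_sub_add_mem (x' j') hT)]
    gcongr
    exact volume_setOf_exists_reprSym_add_latticeVec_mem_le (x' j') hT
  calc ∫⁻ x', ∫⁻ y, Fp (y, x') ≤ ∫⁻ x', (posDomain ε N).indicator 1 x' * volume T :=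
        lintegral_mono hinner
    _ = volume T * volume (posDomain ε N) := by
        rw [lintegral_mul_const _ (measurable_one.indicator (measurableSet_posDomain ε N)),
          lintegral_indicator_one (measurableSet_posDomain ε N), mul_comm]

/-- The Haar measure of a minimal-image ball of radius `ε < 1/2` is at most `(2ε)³`. [folklore] -/
theorem volume_ball_le {ε : ℝ} (hε : 0 ≤ ε) :
    volume (Metric.ball (0 : V3) ε) ≤ ENNReal.ofReal (8 * ε ^ 3) := by
  have hsub : Metric.ball (0 : V3) ε ⊆
      (WithLp.ofLp : V3 → Fin 3 → ℝ) ⁻¹' Set.pi univ (fun _ => Icc (-ε) ε) := by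
    intro y hy
    rw [Metric.mem_ball, dist_zero_right] at hy
    rw [mem_preimage, mem_univ_pi]
    intro i
    have h1 : |y i| ≤ ‖y‖ := by simpa using PiLp.norm_apply_le y i
    rw [mem_Icc]
    constructor <;> linarith [(abs_le.1 (h1.trans hy.le)).1, (abs_le.1 (h1.trans hy.le)).2]
  calc volume (Metric.ball (0 : V3) ε)
      ≤ volume ((WithLp.ofLp : V3 → Fin 3 → ℝ) ⁻¹' Set.pi univ (fun _ => Icc (-ε) ε)) :=
        measure_mono hsub
    _ = volume (Set.pi univ (fun _ : Fin 3 => Icc (-ε) ε)) :=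
        (PiLp.volume_preserving_ofLp (Fin 3)).measure_preimage
          (MeasurableSet.univ_pi fun _ => measurableSet_Icc).nullMeasurableSet
    _ = ENNReal.ofReal (8 * ε ^ 3) := by
        rw [volume_pi_pi]
        simp only [Real.volume_Icc, Finset.prod_const, Finset.card_univ, Fintype.card_fin]
        rw [← ENNReal.ofReal_pow (by linarith)]
        congr 1
        ring

/-- **Ratio bound.** At reduced density `σ ≤ 1/4` the non-overlap sets of `N` and `N + 1` centres
have comparable Haar measures: `vol (posDomain ε_N N) ≤ 2 vol (posDomain ε_N (N+1))`
(`volume_posDomain_succ_ge` with `N vol B_ε ≤ 8(N+1)ε³ = 8σ³ ≤ 1/2`). [folklore] -/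
theorem volume_posDomain_le_two_mul {σ : ℝ} (hσ : 0 < σ) (hσ4 : σ ≤ 1 / 4) (N : ℕ)
    (i : Fin (N + 1)) :
    volume (posDomain (hsDiameter σ N) N) ≤ 2 * volume (posDomain (hsDiameter σ N) (N + 1)) := by
  set ε := hsDiameter σ N with hε
  have hε0 : 0 < ε := hsDiameter_pos hσ N
  have hε2 : ε < 1 / 2 := (hsDiameter_le hσ.le N).trans_lt (by linarith)
  have hball : (N : ℝ≥0∞) * volume (Metric.ball (0 : V3) ε) ≤ 2⁻¹ := by
    have h1 : (N : ℝ≥0∞) * volume (Metric.ball (0 : V3) ε) ≤ ENNReal.ofReal (8 * (N + 1) * ε ^ 3) := by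
      calc (N : ℝ≥0∞) * volume (Metric.ball (0 : V3) ε)
          ≤ (N : ℝ≥0∞) * ENNReal.ofReal (8 * ε ^ 3) := by gcongr; exact volume_ball_le hε0.le
        _ = ENNReal.ofReal (N * (8 * ε ^ 3)) := by
            rw [ENNReal.ofReal_mul (Nat.cast_nonneg N), ENNReal.ofReal_natCast]
        _ ≤ ENNReal.ofReal (8 * (N + 1) * ε ^ 3) :=
            ENNReal.ofReal_le_ofReal (by nlinarith [pow_pos hε0 3])
    have h2 : 8 * ((N : ℝ) + 1) * ε ^ 3 ≤ 2⁻¹ := by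
      have h3 : ((N + 1 : ℕ) : ℝ) * ε ^ 3 = σ ^ 3 := succ_mul_hsDiameter_pow_three σ N
      push_cast at h3
      have h4 : σ ^ 3 ≤ (1 / 4) ^ 3 := pow_le_pow_left₀ hσ.le hσ4 3
      nlinarith
    calc (N : ℝ≥0∞) * volume (Metric.ball (0 : V3) ε) ≤ ENNReal.ofReal (8 * (N + 1) * ε ^ 3) := h1
      _ ≤ ENNReal.ofReal 2⁻¹ := ENNReal.ofReal_le_ofReal h2
      _ = 2⁻¹ := by rw [ENNReal.ofReal_inv_of_pos two_pos, ENNReal.ofReal_ofNat]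
  have hhalf : 2⁻¹ ≤ 1 - (N : ℝ≥0∞) * volume (Metric.ball (0 : V3) ε) := by
    calc (2⁻¹ : ℝ≥0∞) = 1 - 2⁻¹ := ENNReal.one_sub_inv_two.symm
      _ ≤ 1 - (N : ℝ≥0∞) * volume (Metric.ball (0 : V3) ε) := tsub_le_tsub_left hball _
  have hins := volume_posDomain_succ_ge hε2 N i
  calc volume (posDomain ε N) = 2 * (2⁻¹ * volume (posDomain ε N)) := by
        rw [← mul_assoc, ENNReal.mul_inv_cancel two_ne_zero ENNReal.ofNat_ne_top, one_mul]
    _ ≤ 2 * ((1 - (N : ℝ≥0∞) * volume (Metric.ball (0 : V3) ε)) * volume (posDomain ε N)) := by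
        gcongr
    _ ≤ 2 * volume (posDomain ε (N + 1)) := by gcongr

/-- **Velocity marginal.** Under the product of `N + 1` copies of the Gaussian `γ = N(ū, θ)`,
`E ‖vᵢ − vⱼ‖ ≤ 2 E_γ ‖w − ū‖` (triangle inequality and the one-particle marginals,
`measurePreserving_eval`). [folklore] -/
theorem lintegral_enorm_vel_sub_le (ubar : V3) (θ : ℝ) {N : ℕ} (i j : Fin (N + 1)) :
    ∫⁻ v, ‖v i - v j‖ₑ ∂(Measure.pi fun _ : Fin (N + 1) => gaussMeasure ubar θ) ≤
      2 * ∫⁻ w, ‖w - ubar‖ₑ ∂gaussMeasure ubar θ := by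
  have hmarg : ∀ l : Fin (N + 1), ∫⁻ v, ‖v l - ubar‖ₑ ∂(Measure.pi fun _ : Fin (N + 1) => gaussMeasure ubar θ) =
      ∫⁻ w, ‖w - ubar‖ₑ ∂gaussMeasure ubar θ := fun l =>
    (measurePreserving_eval (fun _ : Fin (N + 1) => gaussMeasure ubar θ) l).lintegral_comp
      (f := fun w : V3 => ‖w - ubar‖ₑ) (by fun_prop)
  calc ∫⁻ v, ‖v i - v j‖ₑ ∂(Measure.pi fun _ : Fin (N + 1) => gaussMeasure ubar θ)
      ≤ ∫⁻ v, (‖v i - ubar‖ₑ + ‖v j - ubar‖ₑ) ∂(Measure.pi fun _ : Fin (N + 1) => gaussMeasure ubar θ) := by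
        refine lintegral_mono fun v => ?_
        have : v i - v j = (v i - ubar) - (v j - ubar) := by abel
        rw [this]
        exact enorm_sub_le
    _ = 2 * ∫⁻ w, ‖w - ubar‖ₑ ∂gaussMeasure ubar θ := by
        rw [lintegral_add_left (by fun_prop), hmarg i, hmarg j, two_mul]


end Summit.AtomisticToContinuum.HydrodynamicLimit.Theorems

end
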